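import Summits.ValiantsHypothesis.ValiantsHypothesis.Theorems.NewtonUnitEquationsTwoProductsFullDepthDefs

/-!
# Micro-rung `lagrange-codepth` — L1: VIETA FACTORISATION AT FULL DEPTH (`tailDiff u v = ∏_j (u_j − v_i)`)

`fullDepthFactorisation_holds : FullDepthFactorisation` (val-idea-36 g2's L1, text in `…FullDepthDefs`).  Proof: put
`Q_w(Z) := ∏_j (Z + w_j) ∈ ℂ[X,Y][Z]`; by Vieta (`Finset.prod_X_add_C_coeff`) the `Z^k`-coefficient of `Q_w` is the elementary
symmetric layer `esymmTail (m − k) w`, so under `FullDepth u v` (layers `0 < k < m` agree; layer `0` is `1`) the difference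
`Q_u − Q_v` is a CONSTANT polynomial; evaluating at `Z = 1` gives `∏(1+u_j) − ∏(1+v_j) = tailDiff u v`, and at `Z = −v_i` gives
`∏_j (u_j − v_i) − 0`.  Helper mode (`--supports stmt-ValiantsHypothesis-5906 --as helper`).  Honest framing: a micro-rung identity
(co-depth `0`); nothing here closes 5906 (`TwoProducts` / `ResidualLawV23` / `PlanarCellBound` OPEN); VP ≠ VNP is NOT proved.
No instances, no notation, no named facts. [folklore]
-/

noncomputable section
set_option linter.dupNamespace false

namespace Summit.ValiantsHypothesis.ValiantsHypothesis.Theorems.NewtonUnitEquations.TwoProducts.FullDepth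
open scoped BigOperators
open MvPolynomial
open Summit.ValiantsHypothesis.ValiantsHypothesis.Theorems.NewtonUnitEquations.TwoProducts.FormalLogLinearisation
open Summit.ValiantsHypothesis.ValiantsHypothesis.Theorems.NewtonUnitEquations.TwoProducts.PlanarCell

variable {m : ℕ}

/-- `Q_w(Z) = ∏_j (Z + w_j)` has `Z`-degree at most `m`. [folklore] -/
theorem natDegree_prod_X_add_C_le (w : Fin m → MvPolynomial (Fin 2) ℂ) :
    (∏ j, (Polynomial.X + Polynomial.C (w j))).natDegree ≤ m := by
  refine (Polynomial.natDegree_prod_le _ _).trans ?_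
  simp

/-- **Vieta**: the `Z^k`-coefficient of `∏_j (Z + w_j)` is the elementary symmetric layer `e_{m−k}(w)` of the tails. [folklore] -/
theorem coeff_prod_X_add_C_eq_esymmTail (w : Fin m → MvPolynomial (Fin 2) ℂ) (k : ℕ) (hk : k ≤ m) :
    (∏ j, (Polynomial.X + Polynomial.C (w j))).coeff k = esymmTail (m - k) w := by
  classical
  have h := Finset.prod_X_add_C_coeff (Finset.univ : Finset (Fin m)) w (k := k) (by simpa using hk)
  rw [h]
  unfold esymmTail
  simp [Finset.card_univ, Fintype.card_fin]

/-- The layer `e_0` is `1`. [folklore] -/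
theorem esymmTail_zero (w : Fin m → MvPolynomial (Fin 2) ℂ) : esymmTail 0 w = 1 := by
  classical
  unfold esymmTail
  simp [Finset.powersetCard_zero]

/-- At full depth `∏_j (Z + u_j) − ∏_j (Z + v_j)` is a constant polynomial in `Z`. [folklore] -/
theorem prod_X_add_C_sub_eq_C (u v : Fin m → MvPolynomial (Fin 2) ℂ) (hfd : FullDepth u v) :
    (∏ j, (Polynomial.X + Polynomial.C (u j))) - ∏ j, (Polynomial.X + Polynomial.C (v j)) =
      Polynomial.C (((∏ j, (Polynomial.X + Polynomial.C (u j))) - ∏ j, (Polynomial.X + Polynomial.C (v j))).coeff 0) := by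
  ext k
  rw [Polynomial.coeff_C]
  split_ifs with hk
  · rw [hk]
  · rw [Polynomial.coeff_sub]
    by_cases hkm : k ≤ m
    · rw [coeff_prod_X_add_C_eq_esymmTail u k hkm, coeff_prod_X_add_C_eq_esymmTail v k hkm]
      by_cases hkm' : k = m
      · subst hkm'
        rw [Nat.sub_self, esymmTail_zero, esymmTail_zero, sub_self]
      · rw [hfd (m - k) (by omega) (by omega), sub_self]
    · push Not at hkm
      rw [Polynomial.coeff_eq_zero_of_natDegree_lt ((natDegree_prod_X_add_C_le u).trans_lt hkm),
        Polynomial.coeff_eq_zero_of_natDegree_lt ((natDegree_prod_X_add_C_le v).trans_lt hkm), sub_self]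

/-- **L1 — VIETA FACTORISATION AT FULL DEPTH** (`FullDepthFactorisation`, val-idea-36 g2's text verbatim in `…FullDepthDefs`): if all
elementary symmetric layers `e_k`, `0 < k < m`, of the two tail families agree, then `∏(1+u_j) − ∏(1+v_j) = ∏_j (u_j − v_i)` for every
`i`. [folklore] -/
theorem fullDepthFactorisation_holds : FullDepthFactorisation := by
  intro m u v hfd i
  classical
  have hconst := prod_X_add_C_sub_eq_C u v hfd
  have hev1 : ((∏ j, (Polynomial.X + Polynomial.C (u j))) - ∏ j, (Polynomial.X + Polynomial.C (v j))).eval 1 =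
      tailDiff u v := by
    simp only [tailDiff, Polynomial.eval_sub, Polynomial.eval_prod, Polynomial.eval_add, Polynomial.eval_X,
      Polynomial.eval_C]
  have hev2 : ((∏ j, (Polynomial.X + Polynomial.C (u j))) - ∏ j, (Polynomial.X + Polynomial.C (v j))).eval (-v i) =
      ∏ j, (u j - v i) := by
    rw [Polynomial.eval_sub, Polynomial.eval_prod, Polynomial.eval_prod]
    have hz : ∏ j, Polynomial.eval (-v i) (Polynomial.X + Polynomial.C (v j)) = 0 :=
      Finset.prod_eq_zero (Finset.mem_univ i) (by simp)
    rw [hz, sub_zero]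
    exact Finset.prod_congr rfl fun j _ => by simp; ring
  have hc1 := congrArg (Polynomial.eval (1 : MvPolynomial (Fin 2) ℂ)) hconst
  have hc2 := congrArg (Polynomial.eval (-v i)) hconst
  simp only [Polynomial.eval_C] at hc1 hc2
  rw [← hev1, ← hev2, hc1, hc2]

end Summit.ValiantsHypothesis.ValiantsHypothesis.Theorems.NewtonUnitEquations.TwoProducts.FullDepth

end
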